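import Mathlib
import HarnessLib

/-!
# `∑_{odd ν} 1/ν² = π²/8` as an upper bound for the odd partial sums (route EtaLeadingQuarter,
item `EtaLeadingSecondMoment`, stmt-RiemannHypothesis-21791; BRIEF-L18-K1 §1)

The leading constant `1/4` of `EtaLeadingSecondMoment` is `(2/π²)·∑_{ν odd} 1/ν² = (2/π²)(π²/8)`:
the diagonal of the dual main term `2|∑_{odd ν ≤ 2y} ν^{−1/2+it}|²` weighted by the zero density.
Here: `hasSum_odd_inv_sq` (`∑_{k} 1/(2k+1)² = π²/8`, from Mathlib's `hasSum_zeta_two` by the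
even/odd split) and the finite upper bound `sum_odd_inv_sq_le` used by the diagonal estimate.
RH-free; nothing here bears on the truth of RH.
-/

noncomputable section

open Finset
open scoped Real

set_option linter.dupNamespace false  -- the mandated namespace repeats `RiemannHypothesis`

namespace Summit.RiemannHypothesis.RiemannHypothesis.Theorems.EtaLeadingQuarter.EtaTrial

/-- `∑_{k≥0} 1/(2k+1)² = π²/8`. [folklore] -/
theorem hasSum_odd_inv_sq :
    HasSum (fun k : ℕ ↦ (1 : ℝ) / ((2 * k + 1 : ℕ) : ℝ) ^ 2) (π ^ 2 / 8) := by
  have hall := hasSum_zeta_two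
  -- even part: `∑ 1/(2k)² = π²/24`
  have heven : HasSum (fun k : ℕ ↦ (1 : ℝ) / ((2 * k : ℕ) : ℝ) ^ 2) (π ^ 2 / 24) := by
    have h := hall.mul_left (1 / 4)
    have e : (fun k : ℕ ↦ (1 : ℝ) / ((2 * k : ℕ) : ℝ) ^ 2) = fun k : ℕ ↦ 1 / 4 * (1 / (k : ℝ) ^ 2) := by
      funext k
      push_cast
      rcases Nat.eq_zero_or_pos k with hk | hk
      · subst hk; simp
      · have : (k : ℝ) ≠ 0 := by exact_mod_cast hk.ne'
        field_simp
        ring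
    rw [e, show (π ^ 2 / 24 : ℝ) = 1 / 4 * (π ^ 2 / 6) by ring]
    exact h
  -- odd part is summable
  have hodd_summ : Summable fun k : ℕ ↦ (1 : ℝ) / ((2 * k + 1 : ℕ) : ℝ) ^ 2 :=
    hall.summable.comp_injective
      ((add_left_injective 1).comp (mul_right_injective₀ (two_ne_zero' ℕ)))
  obtain ⟨S, hS⟩ := hodd_summ
  have htot : HasSum (fun n : ℕ ↦ (1 : ℝ) / (n : ℝ) ^ 2) (π ^ 2 / 24 + S) :=
    HasSum.even_add_odd heven hS
  have hS' : S = π ^ 2 / 8 := by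
    have := hall.unique htot
    linarith
  rwa [hS'] at hS

/-- **`∑_{odd ν ≤ V} 1/ν² ≤ π²/8`.** [folklore] -/
theorem sum_odd_inv_sq_le (V : ℕ) :
    ∑ ν ∈ (Finset.Icc 1 V).filter (fun ν ↦ ¬Even ν), (1 : ℝ) / (ν : ℝ) ^ 2 ≤ π ^ 2 / 8 := by
  classical
  -- reindex the odd `ν ≤ V` as `ν = 2k+1`, `k < (V+1)/2`
  have himage : (Finset.Icc 1 V).filter (fun ν ↦ ¬Even ν) =
      (Finset.range ((V + 1) / 2)).image (fun k ↦ 2 * k + 1) := by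
    ext ν
    simp only [Finset.mem_filter, Finset.mem_Icc, Finset.mem_image, Finset.mem_range,
      Nat.not_even_iff_odd]
    constructor
    · rintro ⟨⟨h1, h2⟩, ⟨k, hk⟩⟩
      exact ⟨k, by omega, by omega⟩
    · rintro ⟨k, hk, rfl⟩
      exact ⟨⟨by omega, by omega⟩, ⟨k, rfl⟩⟩
  have hinj : Set.InjOn (fun k : ℕ ↦ 2 * k + 1) ↑(Finset.range ((V + 1) / 2)) :=
    fun a _ b _ h ↦ by simpa using h
  rw [himage, Finset.sum_image hinj]
  have h := hasSum_odd_inv_sq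
  have hnn : ∀ k : ℕ, 0 ≤ (1 : ℝ) / ((2 * k + 1 : ℕ) : ℝ) ^ 2 := fun k ↦ by positivity
  have hle := sum_le_hasSum (Finset.range ((V + 1) / 2)) (fun k _ ↦ hnn k) h
  refine le_trans (le_of_eq ?_) hle
  refine Finset.sum_congr rfl fun k _ ↦ ?_
  push_cast
  ring

end Summit.RiemannHypothesis.RiemannHypothesis.Theorems.EtaLeadingQuarter.EtaTrial

end
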